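import Summits.QuantumAdvantage.QuantumAdvantage.Theorems.CubicForrelationSignedExactSliceIsLiftDefs

/-!
# Stub `stub_moebius` of line `Sketch` (crux K2 `SignedExactSliceIsLift`, stmt-QuantumAdvantage-14830)

The RM(3) binary Möbius algebra behind the canonicaliser, in the list vocabulary of the Defs file.
(i) For ANY oracle `F`, `truncOf n F = evalMonos n (cubicMonomials n F)` is an XOR of values
`monoVal n S ·` of monomials in at most three literals, each literal a coordinate or the constant `false`;
degrees add under conjunction and do not grow under XOR (`p·q`, `p+q` over `𝔽₂`), so it is cubic.
(ii) For a cubic `f = [p = 1]`, `deg p ≤ 3`, read in `𝔽₂` the truncated interpolant is a linear functional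
(`bz_truncOf`) of the point data `c T = [f (1_T)]`; on a Boolean point `p` evaluates to
`Σ_m coeff_m · [supp m ⊆ supp y]` with `|supp m| ≤ 3` (`eval_bz`), so by linearity (`Tr_sum`) it suffices to
treat an indicator `y ↦ [A ⊆ supp y]`, `|A| ≤ 3` (`Tr_ind`). There the Möbius coefficient at a duplicate-free
list `S` is the parity of `#{T ⊆ S : A ⊆ T} = 2^{|S∖A|}·[A ⊆ S]`, i.e. `[S = A]` (`sum_subInd`, induction on
`S`), and the blocks of `subsets3 n` enumerate every `≤ 3`-subset of `{0,…,n-1}` exactly once as its increasing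
list (`sum_subsets3`, by the colex recursions `sum_block1/2/3`), whence the value `[A ⊆ supp x]`: binary Möbius
inversion on the weight-`≤ 3` down-set. [cite: Carlet2020, §2.2.1 (ANF, binary Möbius transform)]
-/

set_option linter.dupNamespace false -- D-0017: single-problem summit ⇒ `QuantumAdvantage.QuantumAdvantage` by design

noncomputable section

namespace Summit.QuantumAdvantage.QuantumAdvantage.Theorems.SignedExactSliceIsLift

open _root_.Computability Literature.Computability.Complexity Literature.Computability.Cryptography
  Literature.Computability.QuantumComplexity
open Literature.Computability.Complexity.CodeFP (strE unE natE bitE pairE rawE)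
open Summit.QuantumAdvantage.QuantumAdvantage.Theses.CubicForrelation (NearExactIsExact SignedExactSliceIsLift)

namespace StubMoebius

variable {n : ℕ}

/-- Degree `≤ d` is closed under XOR (`p + q`). [cite: Carlet2020, §2.2.1 Def. 6] -/
theorem isDegLeFun_xor {d : ℕ} {f g : (Fin n → Bool) → Bool} (hf : IsDegLeFun d f) (hg : IsDegLeFun d g) :
    IsDegLeFun d (fun x => xor (f x) (g x)) := by
  have key : ∀ a b : ZMod 2, decide (a + b = 1) = xor (decide (a = 1)) (decide (b = 1)) := by decide
  obtain ⟨p, hp, hpf⟩ := hf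
  obtain ⟨q, hq, hqg⟩ := hg
  refine ⟨p + q, (MvPolynomial.totalDegree_add p q).trans (max_le hp hq), fun x => ?_⟩
  show xor (f x) (g x) = _
  rw [hpf x, hqg x, polyPhase_apply, polyPhase_apply, polyPhase_apply, map_add, key]

/-- Degrees add under conjunction (`p · q`). [cite: Carlet2020, §2.2.1 Def. 6] -/
theorem isDegLeFun_and {a b : ℕ} {f g : (Fin n → Bool) → Bool} (hf : IsDegLeFun a f) (hg : IsDegLeFun b g) :
    IsDegLeFun (a + b) (fun x => (f x && g x)) := by
  have key : ∀ a b : ZMod 2, decide (a * b = 1) = (decide (a = 1) && decide (b = 1)) := by decide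
  obtain ⟨p, hp, hpf⟩ := hf
  obtain ⟨q, hq, hqg⟩ := hg
  refine ⟨p * q, (MvPolynomial.totalDegree_mul p q).trans (Nat.add_le_add hp hq), fun x => ?_⟩
  show (f x && g x) = _
  rw [hpf x, hqg x, polyPhase_apply, polyPhase_apply, polyPhase_apply, map_mul, key]

/-- A literal `litVal n · i` (a coordinate, or the constant `false` when `i ≥ n`) has degree `≤ 1`.
[cite: Carlet2020, §2.2.1 Def. 6] -/
theorem isDegLeFun_litVal (i : ℕ) : IsDegLeFun 1 (fun x : Fin n → Bool => litVal n x i) := by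
  by_cases h : i < n
  · rw [show (fun x : Fin n → Bool => litVal n x i) = fun x => x ⟨i, h⟩ from funext fun x => dif_pos h]
    exact isDegLeFun_apply ⟨i, h⟩ le_rfl
  · rw [show (fun x : Fin n → Bool => litVal n x i) = fun _ => false from funext fun x => dif_neg h]
    exact isDegLeFun_const 1 false

/-- A conjunction of `|L|` literals has degree `≤ |L|`. [cite: Carlet2020, §2.2.1 Def. 6] -/
theorem isDegLeFun_all (L : List ℕ) : IsDegLeFun L.length (fun x : Fin n → Bool => L.all (litVal n x)) := by
  induction L with
  | nil => exact isDegLeFun_const 0 true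
  | cons i L ih =>
      rw [show (fun x : Fin n → Bool => (i :: L).all (litVal n x)) =
          fun x => (litVal n x i && L.all (litVal n x)) from funext fun x => List.all_cons]
      exact (isDegLeFun_and (isDegLeFun_litVal i) ih).mono (by rw [List.length_cons]; omega)

/-- A monomial value `monoVal n S ·` (at most three literals) is cubic. [cite: Carlet2020, §2.2.1 Def. 6] -/
theorem isDegLeFun_monoVal (S : List ℕ) : IsDegLeFun 3 (fun x : Fin n → Bool => monoVal n S x) :=
  (isDegLeFun_all (S.take 3)).mono (List.length_take_le 3 S)

/-- An XOR of monomial values accumulated onto a cubic start is cubic. [cite: Carlet2020, §2.2.1 Def. 6] -/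
theorem isDegLeFun_foldl (mons : List (List ℕ)) : ∀ {g : (Fin n → Bool) → Bool}, IsDegLeFun 3 g →
    IsDegLeFun 3 (fun x => mons.foldl (fun acc S => xor acc (monoVal n S x)) (g x)) := by
  induction mons with
  | nil => intro g hg; exact hg
  | cons S mons ih =>
      intro g hg
      exact ih (g := fun x => xor (g x) (monoVal n S x)) (isDegLeFun_xor hg (isDegLeFun_monoVal S))

/-- **Part (i)**: `evalMonos n mons` is cubic for every monomial list. [cite: Carlet2020, §2.2.1 Def. 6] -/
theorem isDegLeFun_evalMonos (mons : List (List ℕ)) : IsDegLeFun 3 (evalMonos n mons) :=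
  isDegLeFun_foldl mons (g := fun _ => false) (isDegLeFun_const 3 false)

/-- A left fold of XORs is a sum in `𝔽₂` (Booleans read `true ↦ 1`, the convention of `polyPhase`). [folklore] -/
theorem bz_foldl_xor {α : Type*} (g : α → Bool) (l : List α) (a : Bool) :
    (if l.foldl (fun acc s => xor acc (g s)) a then (1 : ZMod 2) else 0) =
      (if a then (1 : ZMod 2) else 0) + (l.map fun s => if g s then (1 : ZMod 2) else 0).sum := by
  have hx : ∀ a b : Bool, (if xor a b then (1 : ZMod 2) else 0) =
      (if a then (1 : ZMod 2) else 0) + (if b then (1 : ZMod 2) else 0) := by decide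
  induction l generalizing a with
  | nil => simp
  | cons s l ih => rw [List.foldl_cons, ih, List.map_cons, List.sum_cons, hx, add_assoc]

/-- Summing over a filtered list is summing against the indicator of the filter. [folklore] -/
theorem sum_map_filter_eq {α : Type*} (P : α → Bool) (g : α → ZMod 2) (l : List α) :
    ((l.filter P).map g).sum = (l.map fun s => (if P s then (1 : ZMod 2) else 0) * g s).sum := by
  induction l with
  | nil => rfl
  | cons s l ih =>
      rw [List.map_cons, List.sum_cons, ← ih, List.filter_cons]
      cases P s <;> simp

/-- Splitting the `(k+1)`-subsets of `{0,…,n}` by membership of `n`. [folklore] -/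
theorem sum_powersetCard_succ {M : Type*} [AddCommMonoid M] (k n : ℕ) (G : Finset ℕ → M) :
    ∑ B ∈ (Finset.range (n + 1)).powersetCard (k + 1), G B =
      ∑ B ∈ (Finset.range n).powersetCard (k + 1), G B +
        ∑ B ∈ (Finset.range n).powersetCard k, G (insert n B) := by
  have hdisj : Disjoint ((Finset.range n).powersetCard (k + 1))
      (((Finset.range n).powersetCard k).image (insert n)) := by
    refine Finset.disjoint_left.2 fun B h1 h2 => ?_
    obtain ⟨B', -, rfl⟩ := Finset.mem_image.1 h2
    exact Finset.notMem_range_self ((Finset.mem_powersetCard.1 h1).1 (Finset.mem_insert_self n B'))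
  have hinj : Set.InjOn (fun B : Finset ℕ => insert n B) ((Finset.range n).powersetCard k : Set (Finset ℕ)) := by
    intro B₁ h₁ B₂ h₂ (h : insert n B₁ = insert n B₂)
    have e₁ : n ∉ B₁ := fun hn => Finset.notMem_range_self ((Finset.mem_powersetCard.1 h₁).1 hn)
    have e₂ : n ∉ B₂ := fun hn => Finset.notMem_range_self ((Finset.mem_powersetCard.1 h₂).1 hn)
    rw [← Finset.erase_insert e₁, h, Finset.erase_insert e₂]
  rw [Finset.range_add_one, Finset.powersetCard_succ_insert Finset.notMem_range_self, Finset.sum_union hdisj,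
    Finset.sum_image hinj]

/-- Sorting after inserting a new maximum appends it. [folklore] -/
theorem sort_insert_max {B : Finset ℕ} {n : ℕ} (h : ∀ b ∈ B, b < n) :
    (insert n B).sort (· ≤ ·) = B.sort (· ≤ ·) ++ [n] := by
  have hlt : ∀ a ∈ B.sort (· ≤ ·), ∀ b ∈ [n], a < b := fun a ha b hb => by
    rw [List.mem_singleton.1 hb]; exact h a ((Finset.mem_sort _).1 ha)
  have hnd : (B.sort (· ≤ ·) ++ [n]).Nodup := List.nodup_append.2
    ⟨Finset.sort_nodup _ _, List.nodup_singleton n, fun a ha b hb => (hlt a ha b hb).ne⟩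
  have ht : (B.sort (· ≤ ·) ++ [n]).toFinset = insert n B := by ext a; simp
  rw [← ht]
  exact (List.toFinset_sort (· ≤ ·) hnd).2 (List.pairwise_append.2 ⟨Finset.pairwise_sort _ _,
    List.pairwise_singleton _ _, fun a ha b hb => (hlt a ha b hb).le⟩)

/-- The new blocks of the colex recursion, as sums over `k`-subsets with `n` inserted. [folklore] -/
theorem sum_insert_sort {M : Type*} [AddCommMonoid M] (k n : ℕ) (g : List ℕ → M) :
    ∑ B ∈ (Finset.range n).powersetCard k, g ((insert n B).sort (· ≤ ·)) =
      ∑ B ∈ (Finset.range n).powersetCard k, g (B.sort (· ≤ ·) ++ [n]) :=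
  Finset.sum_congr rfl fun B hB => by
    rw [sort_insert_max fun b hb => Finset.mem_range.1 ((Finset.mem_powersetCard.1 hB).1 hb)]

/-- Block 1 of `subsets3`: singletons are the `1`-subsets. [folklore] -/
theorem sum_block1 {M : Type*} [AddCommMonoid M] (g : List ℕ → M) : ∀ n : ℕ,
    ((List.range n).map fun i => g [i]).sum = ∑ B ∈ (Finset.range n).powersetCard 1, g (B.sort (· ≤ ·))
  | 0 => by rw [Finset.range_zero, Finset.powersetCard_eq_empty.2 (by simp)]; simp
  | n + 1 => by
      rw [List.range_succ, List.map_append, List.sum_append, sum_block1 g n, sum_powersetCard_succ,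
        sum_insert_sort, Finset.powersetCard_zero, Finset.sum_singleton, Finset.sort_empty]
      simp

/-- Block 2 of `subsets3` (colex pairs) are the `2`-subsets. [folklore] -/
theorem sum_block2 {M : Type*} [AddCommMonoid M] (g : List ℕ → M) : ∀ n : ℕ,
    ((List.range n).flatMap fun j => (List.range j).map fun i => g [i, j]).sum =
      ∑ B ∈ (Finset.range n).powersetCard 2, g (B.sort (· ≤ ·))
  | 0 => by rw [Finset.range_zero, Finset.powersetCard_eq_empty.2 (by simp)]; simp
  | n + 1 => by
      have h1 := sum_block1 (g ∘ (· ++ [n])) n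
      simp only [Function.comp_apply, List.cons_append, List.nil_append] at h1
      rw [List.range_succ, List.flatMap_append, List.flatMap_singleton, List.sum_append, sum_block2 g n, h1,
        sum_powersetCard_succ, sum_insert_sort]

/-- Block 3 of `subsets3` (colex triples) are the `3`-subsets. [folklore] -/
theorem sum_block3 {M : Type*} [AddCommMonoid M] (g : List ℕ → M) : ∀ n : ℕ,
    ((List.range n).flatMap fun l => (List.range l).flatMap fun j => (List.range j).map fun i => g [i, j, l]).sum =
      ∑ B ∈ (Finset.range n).powersetCard 3, g (B.sort (· ≤ ·))
  | 0 => by rw [Finset.range_zero, Finset.powersetCard_eq_empty.2 (by simp)]; simp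
  | n + 1 => by
      have h2 := sum_block2 (g ∘ (· ++ [n])) n
      simp only [Function.comp_apply, List.cons_append, List.nil_append] at h2
      rw [List.range_succ, List.flatMap_append, List.flatMap_singleton, List.sum_append, sum_block3 g n, h2,
        sum_powersetCard_succ, sum_insert_sort]

/-- **Enumeration**: a sum over `subsets3 n` is the sum over all subsets of `{0,…,n-1}` of size `≤ 3`, each
read once as its increasing list. [cite: Carlet2020, §2.2.1] -/
theorem sum_subsets3 {M : Type*} [AddCommMonoid M] (n : ℕ) (g : List ℕ → M) :
    ((subsets3 n).map g).sum =
      ∑ k ∈ Finset.range 4, ∑ B ∈ (Finset.range n).powersetCard k, g (B.sort (· ≤ ·)) := by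
  simp only [subsets3, List.map_append, List.sum_append, List.map_cons, List.map_nil, List.sum_cons,
    List.sum_nil, add_zero, List.map_flatMap, List.map_map, Function.comp_def]
  rw [sum_block1 g n, sum_block2 g n, sum_block3 g n]
  simp only [Finset.sum_range_succ, Finset.sum_range_zero, zero_add, Finset.powersetCard_zero,
    Finset.sum_singleton, Finset.sort_empty, add_assoc]

/-- **Parity count** `#{T ⊆ l : A ⊆ T} = 2^{|l ∖ A|}·[A ⊆ l] ≡ [l = A] (mod 2)` for a duplicate-free
list `l`, by induction on `l`. [cite: Carlet2020, §2.2.1 (binary Möbius transform)] -/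
theorem sum_subInd : ∀ (l : List ℕ), l.Nodup → ∀ A : Finset ℕ,
    ((l.sublists').map fun T => if A ⊆ T.toFinset then (1 : ZMod 2) else 0).sum = if l.toFinset = A then 1 else 0
  | [], _, A => by
      rw [List.sublists'_nil, List.map_cons, List.map_nil, List.sum_cons, List.sum_nil, add_zero,
        List.toFinset_nil]
      exact if_congr (Finset.subset_empty.trans eq_comm) rfl rfl
  | a :: l, hnd, A => by
      rw [List.nodup_cons] at hnd
      have hal : a ∉ l.toFinset := fun h => hnd.1 (List.mem_toFinset.1 h)
      have two : ∀ v : ZMod 2, v + v = 0 := by decide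
      have hcons : (fun T : List ℕ => if A ⊆ T.toFinset then (1 : ZMod 2) else 0) ∘ List.cons a =
          fun T => if A.erase a ⊆ T.toFinset then 1 else 0 := funext fun T => by
        rw [Function.comp_apply, List.toFinset_cons]; exact if_congr Finset.subset_insert_iff rfl rfl
      rw [List.sublists'_cons, List.map_append, List.sum_append, List.map_map, hcons,
        sum_subInd l hnd.2 (A.erase a), List.toFinset_cons]
      by_cases haA : a ∈ A
      · rw [List.sum_eq_zero, zero_add]
        · refine if_congr ⟨fun h => ?_, fun h => ?_⟩ rfl rfl
          · rw [h, Finset.insert_erase haA]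
          · rw [← h, Finset.erase_insert hal]
        · intro v hv
          obtain ⟨T, hT, rfl⟩ := List.mem_map.1 hv
          exact if_neg fun hAT => hnd.1 ((List.mem_sublists'.1 hT).subset (List.mem_toFinset.1 (hAT haA)))
      · rw [Finset.erase_eq_of_notMem haA, sum_subInd l hnd.2 A, two]
        exact (if_neg fun h : insert a l.toFinset = A => haA (h ▸ Finset.mem_insert_self a l.toFinset)).symm

/-- Reading the indicator vector `indic n T` as an input gives the point with support `T`. [folklore] -/
theorem toInput_indic (T : List ℕ) : ForrCode.toInput n (indic n T) = fun i : Fin n => decide ((i : ℕ) ∈ T) := by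
  funext i
  simp [ForrCode.toInput, indic, i.isLt]

/-- `truncOf` read in `𝔽₂` is the truncated Möbius operator
`c ↦ Σ_{S ∈ subsets3 n} (Σ_{T ⊆ S} c T)·[S ⊆ supp x]` applied to the point values `c T = [f (1_T)]`.
[cite: Carlet2020, §2.2.1] -/
theorem bz_truncOf (f : (Fin n → Bool) → Bool) (x : Fin n → Bool) :
    (if truncOf n (fun v => f (ForrCode.toInput n v)) x then (1 : ZMod 2) else 0) =
      ((subsets3 n).map fun S => (((S.take 3).sublists').map fun T =>
        if f (fun i : Fin n => decide ((i : ℕ) ∈ T)) then (1 : ZMod 2) else 0).sum *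
          (if monoVal n S x then (1 : ZMod 2) else 0)).sum := by
  rw [truncOf, evalMonos, bz_foldl_xor, cubicMonomials, sum_map_filter_eq]
  simp only [Bool.false_eq_true, if_false, zero_add]
  refine congrArg List.sum (List.map_congr_left fun S _ => ?_)
  simp only [mcoeff, List.foldl_map]
  rw [bz_foldl_xor]
  simp only [Bool.false_eq_true, if_false, zero_add]
  refine congrArg (· * _) (congrArg List.sum (List.map_congr_left fun T _ => ?_))
  rw [toInput_indic]

/-- The truncated Möbius operator is `𝔽₂`-linear in the point data. [folklore] -/
theorem Tr_sum {ι : Type*} (x : Fin n → Bool) (s : Finset ι) (a : ι → ZMod 2) (c : ι → List ℕ → ZMod 2) :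
    ((subsets3 n).map fun S => (((S.take 3).sublists').map fun T => ∑ m ∈ s, a m * c m T).sum *
        (if monoVal n S x then (1 : ZMod 2) else 0)).sum =
      ∑ m ∈ s, a m * ((subsets3 n).map fun S => (((S.take 3).sublists').map (c m)).sum *
        (if monoVal n S x then (1 : ZMod 2) else 0)).sum := by
  classical
  induction s using Finset.induction_on with
  | empty => simp
  | insert m s hm ih =>
      simp only [Finset.sum_insert hm]
      rw [← ih]
      simp only [List.sum_map_add, List.sum_map_mul_left, add_mul, mul_assoc]

/-- A polynomial over `𝔽₂` evaluated at a Boolean point: `Σ_m coeff_m · [supp m ⊆ supp y]` (as `b² = b`).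
[cite: Carlet2020, §2.2.1 eq. (2.1)] -/
theorem eval_bz (p : MvPolynomial (Fin n) (ZMod 2)) (y : Fin n → Bool) :
    MvPolynomial.eval (fun j => if y j then (1 : ZMod 2) else 0) p =
      ∑ m ∈ p.support, p.coeff m * (if ∀ i ∈ m.support, y i = true then 1 else 0) := by
  rw [MvPolynomial.eval_eq]
  refine Finset.sum_congr rfl fun m _ => ?_
  have e : ∀ i ∈ m.support, (if y i then (1 : ZMod 2) else 0) ^ m i = if y i then (1 : ZMod 2) else 0 :=
      fun i hi => by
    have hne : m i ≠ 0 := Finsupp.mem_support_iff.1 hi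
    cases y i
    · simp [hne]
    · simp
  rw [Finset.prod_congr rfl e, Finset.prod_boole]
  congr

/-- A monomial of a polynomial of total degree `≤ d` has at most `d` variables. [folklore] -/
theorem card_support_le {p : MvPolynomial (Fin n) (ZMod 2)} {m : Fin n →₀ ℕ} (hm : m ∈ p.support) :
    m.support.card ≤ p.totalDegree := by
  refine le_trans ?_ (MvPolynomial.le_totalDegree hm)
  rw [Finsupp.sum, Finset.card_eq_sum_ones]
  exact Finset.sum_le_sum fun i hi => Nat.one_le_iff_ne_zero.2 (Finsupp.mem_support_iff.1 hi)

/-- **Möbius inversion on the weight-`≤ 3` down-set, for an indicator `[A ⊆ supp ·]` with `|A| ≤ 3`**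
(index form `A ⊆ {0,…,n-1}`). [cite: Carlet2020, §2.2.1 (binary Möbius transform)] -/
theorem Tr_subInd (x : Fin n → Bool) (A : Finset ℕ) (hcard : A.card ≤ 3) (hsub : A ⊆ Finset.range n) :
    ((subsets3 n).map fun S => (((S.take 3).sublists').map fun T =>
        if A ⊆ T.toFinset then (1 : ZMod 2) else 0).sum * (if monoVal n S x then (1 : ZMod 2) else 0)).sum =
      if ∀ a ∈ A, litVal n x a = true then 1 else 0 := by
  have hval : ∀ B : Finset ℕ, B.card ≤ 3 → (if monoVal n (B.sort (· ≤ ·)) x then (1 : ZMod 2) else 0) =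
      if ∀ a ∈ B, litVal n x a = true then 1 else 0 := by
    intro B hB
    refine if_congr ?_ rfl rfl
    rw [monoVal, List.take_of_length_le (by rw [Finset.length_sort]; exact hB), List.all_eq_true]
    simp only [Finset.mem_sort]
  rw [sum_subsets3]
  calc _ = ∑ k ∈ Finset.range 4, ∑ B ∈ (Finset.range n).powersetCard k,
          (if B = A then (if monoVal n (A.sort (· ≤ ·)) x then (1 : ZMod 2) else 0) else 0) := by
        refine Finset.sum_congr rfl fun k hk => Finset.sum_congr rfl fun B hB => ?_
        have hBk := (Finset.mem_powersetCard.1 hB).2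
        have hk3 : k < 4 := Finset.mem_range.1 hk
        rw [List.take_of_length_le (by rw [Finset.length_sort]; omega),
          sum_subInd _ (Finset.sort_nodup _ _) A, Finset.sort_toFinset]
        by_cases h : B = A
        · rw [if_pos h, if_pos h, one_mul, h]
        · rw [if_neg h, if_neg h, zero_mul]
    _ = ∑ k ∈ Finset.range 4,
          if A.card = k then (if monoVal n (A.sort (· ≤ ·)) x then (1 : ZMod 2) else 0) else 0 := by
        refine Finset.sum_congr rfl fun k _ => ?_
        rw [Finset.sum_ite_eq']
        exact if_congr (Finset.mem_powersetCard.trans ⟨fun h => h.2, fun h => ⟨hsub, h⟩⟩) rfl rfl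
    _ = (if monoVal n (A.sort (· ≤ ·)) x then (1 : ZMod 2) else 0) := by
        rw [Finset.sum_ite_eq, if_pos (Finset.mem_range.2 (by omega))]
    _ = _ := hval A hcard

/-- Möbius inversion for the indicator of `A ⊆ Fin n`, `|A| ≤ 3`. [cite: Carlet2020, §2.2.1] -/
theorem Tr_ind (x : Fin n → Bool) (A : Finset (Fin n)) (hA : A.card ≤ 3) :
    ((subsets3 n).map fun S => (((S.take 3).sublists').map fun T =>
        if ∀ i ∈ A, decide ((i : ℕ) ∈ T) = true then (1 : ZMod 2) else 0).sum *
          (if monoVal n S x then (1 : ZMod 2) else 0)).sum =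
      if ∀ i ∈ A, x i = true then 1 else 0 := by
  have hsub : A.map Fin.valEmbedding ⊆ Finset.range n := fun a ha => by
    obtain ⟨i, -, rfl⟩ := Finset.mem_map.1 ha
    exact Finset.mem_range.2 i.isLt
  have h1 : (fun T : List ℕ => if ∀ i ∈ A, decide ((i : ℕ) ∈ T) = true then (1 : ZMod 2) else 0) =
      fun T => if A.map Fin.valEmbedding ⊆ T.toFinset then 1 else 0 := funext fun T =>
    if_congr (by rw [Finset.subset_iff, Finset.forall_mem_map]; simp) rfl rfl
  have h2 : (∀ a ∈ A.map Fin.valEmbedding, litVal n x a = true) ↔ ∀ i ∈ A, x i = true := by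
    rw [Finset.forall_mem_map]
    refine forall₂_congr fun i _ => ?_
    simp [litVal]
  rw [h1, Tr_subInd x _ (by rwa [Finset.card_map]) hsub]
  exact if_congr h2 rfl rfl

/-- **Part (ii)**: on a cubic `f` read through `ForrCode.toInput`, the truncated interpolant is `f`.
[cite: Carlet2020, §2.2.1 (binary Möbius transform, uniqueness of the ANF)] -/
theorem truncOf_eq (f : (Fin n → Bool) → Bool) (hf : IsDegLeFun 3 f) :
    truncOf n (fun v => f (ForrCode.toInput n v)) = f := by
  obtain ⟨p, hp, hfp⟩ := hf
  have hinj : ∀ a b : Bool, (if a then (1 : ZMod 2) else 0) = (if b then (1 : ZMod 2) else 0) → a = b := by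
    decide
  have hdec : ∀ v : ZMod 2, (if decide (v = 1) then (1 : ZMod 2) else 0) = v := by decide
  have hbz : ∀ y, (if f y then (1 : ZMod 2) else 0) =
      ∑ m ∈ p.support, p.coeff m * (if ∀ i ∈ m.support, y i = true then 1 else 0) :=
    fun y => by rw [hfp y, polyPhase_apply, hdec]; exact eval_bz p y
  funext x
  apply hinj
  rw [bz_truncOf]
  simp only [hbz]
  rw [Tr_sum]
  exact Finset.sum_congr rfl fun m hm => by rw [Tr_ind x m.support ((card_support_le hm).trans hp)]

end StubMoebius

/-- **STUB M (RM(3) Möbius algebra in list form)**: the degree-3 truncated Möbius interpolant of ANY oracle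
is cubic, and on a cubic function read through `ForrCode.toInput` it is the function itself (binary
Möbius inversion on the weight-≤3 down-set). [cite: Carlet2020, §2.2.1 (ANF, binary Möbius transform)] -/
theorem stub_moebius :
    (∀ (n : ℕ) (F : List Bool → Bool), IsDegLeFun 3 (truncOf n F)) ∧
    (∀ (n : ℕ) (f : (Fin n → Bool) → Bool), IsDegLeFun 3 f →
      truncOf n (fun v => f (ForrCode.toInput n v)) = f) :=
  ⟨fun n F => StubMoebius.isDegLeFun_evalMonos (cubicMonomials n F),
    fun _ f hf => StubMoebius.truncOf_eq f hf⟩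

end Summit.QuantumAdvantage.QuantumAdvantage.Theorems.SignedExactSliceIsLift

end
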